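import Summits.BirchSwinnertonDyer.BirchSwinnertonDyer.Theorems.Rank2ObservatoryPadicAtlasKitOddFac
import Summits.BirchSwinnertonDyer.BirchSwinnertonDyer.Theorems.Rank2ObservatoryAnomHeightFreeOdd
import Summits.BirchSwinnertonDyer.BirchSwinnertonDyer.Theorems.Rank2ObservatoryPadicAtlasP3R3A00
import HarnessLib

/-!
# BirchSwinnertonDyer — rank ≥ 2 observatory: the UNIT layer of the atlas kit at a prime dividing `r!`
# (height-free `Ш[3^∞] = 0` and `ord_3 Reg_3 = 3` for a rank-3 unit cell at `p = 3`)

HONEST FRAMING: per-curve certified theorems and census instruments; no claim on BSD in rank ≥ 2.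

Module of the series `Rank2ObservatoryPadic*.lean` (cell `b2b-bsdr2`, padic-2 seat, gen 8). The height-free
unit-cell theorem of the observatory (anom seat: `Rank2ObservatoryAnomHeightFreeBounds.lean` §3
`norm_coeff_eq_one_of_symbolCertL`, `Rank2ObservatoryAnomHeightFree.lean` `sha_card_eq_one_of_unit_leadingCoeff` /
`AtlasCurve3.heightFreeRow`, `Rank2ObservatoryAnomHeightFreeOdd.lean` `sha_card_eq_one_heightFree_odd` /
`AtlasCurve.heightFreeRowOdd`) reads `‖[T^r] L_p(E,T)‖ = 1` off a kernel-checked symbol certificate through the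
squeeze `norm_coeff_eq_one_of_symbolTableL`, whose hypothesis `p ∤ r!` excludes exactly one class of the census
instruments: RANK `3` AT `p = 3` (`3 ∣ 3!`) — the 242 cells of the parts `Rank2ObservatoryPadicAtlasP3R3A00–15.lean`,
certified by this seat's kit `Rank2ObservatoryPadicAtlasKitOddFac.lean` (`SymbolCertL.validLv`: the kernel finds
`v` with `p^v ‖ r!` and tests `p^{n−v} ∤ A·H − L`). This file is the unit layer of that kit; nothing of the kit
or of the anom files is restated:

* §1 `norm_coeff_eq_one_of_symbolTableLv` — `‖[T^r] L_p‖ = 1` from a level-`p^{n+1}` plus-symbol table, the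
  digits `A` of the unit root, `p ∤ A·H − L` and `p^v ‖ r!` with `v < n` (witnessed `p^v · m = r!`, `p ∤ m`):
  the Riemann sum has norm `‖αH − L‖ = ‖AH − L‖ = 1` and the truncation error is `p^{−n}/‖r!‖_p = p^{−(n−v)} < 1`
  (`norm_padicLCoeff_eq_of_lt`); for `v = 0` it is `norm_coeff_eq_one_of_symbolTableL` verbatim;
* §2 `norm_coeff_eq_one_of_symbolCertLv` — the same from a `SymbolCertL` passing `validLv` AND the anom seat's
  unit flag `unitL` (`p ∤ A·H − L`); `v < n` is FORCED by `validLv` (`p^{n−v} ∤ A·H − L` is false for `n = v`);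
* §3 `AtlasCurve3.heightFreeRowOdd3` — the HEIGHT-FREE row of a unit cell (`AtlasCell.unitCheck`: `p ∤ A·H − L`,
  `p ∤ a_p − 1`) of a rank-3 curve passing the odd test `AtlasCurve3.checkOdd`: GIVEN the named facts `hS`
  (Perrin-Riou–Schneider at `p > 2`, BMS Thm. 1.7), `hex` (the Mazur–Tate `σ` pair at odd `p`, MST 2006 Thm. 1.3),
  `hkato` (Kato Thm. 17.4), the newform `hf`, `hlow : 3 ≤ rank`, the symbol DATA `hint`/`htab`, and the census
  bits `Surj(E, p)`, `p ∤ ∏c_ℓ`, `p`-primitive admissible multiples: `rank E(ℚ) = 3`, `#Ш(E/ℚ)[p^∞] = 1`,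
  `ord_p Reg_p(E, Dh) = 3` and `‖Reg_p‖ = p^{−3}` for EVERY canonical `Dh` — no height, regulator or generator
  computed (`sha_card_eq_one_heightFree_odd`; at `p = 3` surjectivity mod `3^n` is Wuthrich 2014 Lemma 20, in
  the tree);
* §4 exemplar `18097b1` at `p = 3` (part `P3R3A00`: `a_3 = −1`, `n = 2`, `A = 2`, `H = 148`, `L = −108`,
  `A·H − L = 404 ≡ 2 (mod 3)`, non-anomalous): `rank = 3`, `#Ш(18097b1/ℚ)[3^∞] = 1`, `ord_3 Reg_3 = 3` GIVEN the
  named facts, the newform, the symbol DATA and the census bits — `3 ≤ rank` is NOT a hypothesis (tree theorem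
  `three_le_rank_of_mem_atlasP3R3A00`). Both height ENGINES of the census agree with the prediction at this cell
  (`DIFF_R3A.tsv` of the cell folder: `v_3(Reg^{MST}) = 0` engine A and engine B, `#Ш_an` a `3`-adic unit, 12 digits).

Which rank-3 `p = 3` cells are served: unit (`n = 2`, `3 ∤ A·H − L`) and non-anomalous (`a_3 ∈ {−1, 2}`):
55 of the 246 census cells `(E, 3)` (167 unit, of which 112 anomalous), before the census filters `Surj(E, 3)`,
`3 ∤ ∏c_ℓ`. HYPOTHESES LEDGER of a row: named facts `hS`, `hex`, `hkato`; the newform `hf`; symbol DATA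
`hint`/`htab`; census `hsurj`, `htam`, `hm`/`hadm`; KERNEL-DECIDED `checkOdd`, `minCheck`, `unitCheck`; PROVED
`3 ≤ rank`. Per cell; NOT a class theorem; no census verdict is changed. No `sorry`, no new axioms, no
`native_decide`; no new mathematical objects.

References: B. Mazur, J. Tate, J. Teitelbaum, Invent. Math. 84 (1986), §I.10–I.13; W. Stein, C. Wuthrich,
Math. Comp. 82 (2013), §3 (the `ord_p(j!)` loss), §4.1, Alg. 11.1; K. Kato, Astérisque 295 (2004), Thm. 17.4;
J. Balakrishnan, J. S. Müller, W. Stein, Math. Comp. 85 (2016), Thm. 1.7 and p. 3; B. Mazur, W. Stein, J. Tate,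
Doc. Math. Extra Vol. (2006), Thm. 1.3; C. Wuthrich, J. Number Theory 135 (2014), Lemma 20; J. Cremona,
Algorithms (1997), Table 1, §3.5.
-/

set_option autoImplicit false

-- single-conjunct summit: `Summit.BirchSwinnertonDyer.BirchSwinnertonDyer.…` repeats the name by design
set_option linter.dupNamespace false

noncomputable section

open scoped Classical MatrixGroups ModularForm

open CongruenceSubgroup WeierstrassCurve Literature.NumberTheory.EllipticCurves
  Literature.NumberTheory.EllipticCurves.ModularForms Literature.NumberTheory.EllipticCurves.Rank1Residual

namespace Summit.BirchSwinnertonDyer.BirchSwinnertonDyer.Rank2Observatory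

/-! ## §1. `‖[T^r] L_p‖ = 1` from a symbol table at a prime dividing `r!` -/

section UnitCoeffLv

variable (p : ℕ) [Fact p.Prime]

/-- **`[T^r] L_p` is a `p`-adic UNIT from a level-`p^{n+1}` symbol table and the digits of `α`, for ANY `r`**
(odd good ordinary `p`; `p^v ‖ r!` witnessed by `p^v · m = r!`, `p ∤ m`, and `v < n`): with `A ≡ α (mod p^n)`
and `p ∤ A·ΣHi − ΣLo` one gets `‖RS(r, n)‖ = ‖α ΣHi − ΣLo‖ = ‖A ΣHi − ΣLo‖ = 1 > p^{−(n−v)} = p^{−n}/‖r!‖_p =`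
the truncation error, so `‖[T^r] L_p‖ = ‖RS(r, n)‖ = 1` (`norm_padicLCoeff_eq_of_lt`, `C = 1` by `hint`). For
`v = 0` this is `norm_coeff_eq_one_of_symbolTableL`. [cite: MazurTateTeitelbaum1986Invent, §I.10–I.13]
[cite: SteinWuthrich2013, §3] -/
theorem norm_coeff_eq_one_of_symbolTableLv (hp2 : p ≠ 2) (W : WeierstrassCurve ℚ) [W.IsElliptic]
    [W.IsGloballyMinimal] {N : ℕ} [NeZero N] {f : CuspForm (Gamma0 N) 2}
    (hord : IsOrdinaryAt W p) (hf : IsNewformOf W f) {r : ℕ} (v m : ℕ) (hfac : p ^ v * m = r.factorial)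
    (hm : ¬ p ∣ m) (n : ℕ) (hvn : v < n)
    (tabHi tabLo : List ℤ) (D : ℚ) (hD : ‖(D : ℚ_[p])‖ = 1) (H L A : ℤ)
    (hA : (p : ℤ) ^ n ∣ A ^ 2 - W.frobeniusTrace p * A + p) (hAu : ¬ (p : ℤ) ∣ A)
    (hHL1 : ¬ (p : ℤ) ∣ A * H - L)
    (hcard : (teichSet p (n + 1)).card = torsionOrder p)
    (hunit : ∀ y ∈ teichSet p (n + 1), ∀ s : ZMod (p ^ n),
      ¬ p ∣ (y * ((1 + p : ℕ) : ZMod (p ^ (n + 1))) ^ s.val).val)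
    (hHi : isumL p n tabHi r = H) (hLo : isumL p n tabLo r = L)
    (hint : ∀ x : ℚ, ‖(ratPlusSymbol f x : ℚ_[p])‖ ≤ 1)
    (htab : ∀ u : ℕ, u < p ^ (n + 1) → ¬ p ∣ u →
      ratPlusSymbol f ((u : ℚ) / (p : ℚ) ^ (n + 1)) = (tabHi.getD u 0 : ℚ) / D ∧
      ratPlusSymbol f ((u : ℚ) / (p : ℚ) ^ n) = (tabLo.getD u 0 : ℚ) / D) :
    ‖PowerSeries.coeff r (padicLFunction f (unitRoot W p : ℚ_[p]))‖ = 1 := by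
  have hpP : p.Prime := Fact.out
  have hp1 : (1 : ℝ) < p := by exact_mod_cast hpP.one_lt
  have hp0 : (0 : ℝ) < p := by exact_mod_cast hpP.pos
  have hα : ‖(unitRoot W p : ℚ_[p])‖ = 1 := norm_unitRoot_holds W p hord
  have hαA := norm_unitRoot_sub_int_le p W hord A n hA hAu
  set α : ℚ_[p] := (unitRoot W p : ℚ_[p]) with hαdef
  have hα0 : α ≠ 0 := fun h => by rw [h, norm_zero] at hα; exact zero_ne_one hα
  have hD0 : (D : ℚ_[p]) ≠ 0 := fun h => by rw [h, norm_zero] at hD; exact zero_ne_one hD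
  -- `‖RS(r, n)‖ = 1`
  have hRS : ‖padicLRiemannSum f α r n‖ = 1 := by
    rw [padicLRiemannSum_eq_isumL p f _ r n hp2 tabHi tabLo D hcard hunit htab, hHi, hLo]
    have hαinv : α⁻¹ * α = 1 := inv_mul_cancel₀ hα0
    have hfactor : α⁻¹ ^ (n + 1) * ((((H : ℤ) : ℚ) / D : ℚ) : ℚ_[p]) -
        α⁻¹ ^ (n + 2) * ((((L : ℤ) : ℚ) / D : ℚ) : ℚ_[p]) =
          α⁻¹ ^ (n + 2) * ((D : ℚ_[p]))⁻¹ * (α * H - L) := by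
      push_cast [Rat.cast_div]
      rw [div_eq_mul_inv, div_eq_mul_inv]
      linear_combination (-(α⁻¹ ^ (n + 1) * ((H : ℤ) : ℚ_[p]) * ((D : ℚ_[p]))⁻¹)) * hαinv
    rw [hfactor, norm_mul, norm_mul, norm_pow, norm_inv, hα, inv_one, one_pow, one_mul, norm_inv, hD,
      inv_one, one_mul]
    have h1 : ‖(((A * H - L : ℤ)) : ℚ_[p])‖ = 1 := by
      have hle := Padic.norm_int_le_one (p := p) (A * H - L)
      have hlt : ¬ ‖(((A * H - L : ℤ)) : ℚ_[p])‖ < 1 := by rwa [Padic.norm_intCast_lt_one_iff]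
      exact le_antisymm hle (not_lt.mp hlt)
    have h2 : ‖(α - A) * (H : ℚ_[p])‖ < 1 := by
      rw [norm_mul]
      calc ‖α - A‖ * ‖((H : ℤ) : ℚ_[p])‖ ≤ (p : ℝ) ^ (-(n : ℤ)) * 1 :=
            mul_le_mul hαA (Padic.norm_int_le_one H) (norm_nonneg _)
              (zpow_nonneg (Nat.cast_nonneg _) _)
        _ < 1 := by rw [mul_one]; exact zpow_lt_one_of_neg₀ hp1 (by omega)
    have hsplit : α * H - L = (((A * H - L : ℤ)) : ℚ_[p]) + (α - A) * H := by push_cast; ring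
    rw [hsplit, Padic.add_eq_max_of_ne (by rw [h1]; exact h2.ne'), h1, max_eq_left h2.le]
  -- `‖r!‖_p = p^{-v}` from the witnessed factorisation `p^v · m = r!`, `p ∤ m`
  have hmn : ‖((m : ℕ) : ℚ_[p])‖ = 1 := by
    rw [Padic.norm_natCast_eq_one_iff]
    exact (Nat.Prime.coprime_iff_not_dvd Fact.out).mpr hm
  have hfacn : ‖((r.factorial : ℕ) : ℚ_[p])‖ = (p : ℝ) ^ (-(v : ℤ)) := by
    rw [← hfac, Nat.cast_mul, Nat.cast_pow, norm_mul, norm_pow, Padic.norm_p, hmn, mul_one, inv_pow,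
      ← zpow_natCast, ← zpow_neg]
  -- the truncation error `p^{-(n-v)} < 1 = ‖RS‖`
  have herr : 1 / (p : ℝ) ^ (-(v : ℤ)) * (p : ℝ) ^ (-(n : ℤ)) = (p : ℝ) ^ (-((n - v : ℕ) : ℤ)) := by
    rw [one_div, ← zpow_neg, neg_neg, ← zpow_add₀ hp0.ne', Nat.cast_sub hvn.le]
    congr 1
    ring
  have hC := norm_msdMeasure_le_one p f α hα hint
  have hlt : (1 : ℝ) / ‖((r.factorial : ℕ) : ℚ_[p])‖ * (p : ℝ) ^ (-n : ℤ) <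
      ‖padicLRiemannSum f α r n‖ := by
    rw [hfacn, herr, hRS]
    exact zpow_lt_one_of_neg₀ hp1 (by omega)
  rw [coeff_padicLFunction, (norm_padicLCoeff_eq_of_lt (msdMeasure_distribution_of_isNewformOf hord hf)
    ((norm_nonneg _).trans (hC 0 0)) hC hlt).1, hRS]

/-! ## §2. `‖[T^r] L_p‖ = 1` from a `SymbolCertL` passing `validLv` and the unit test -/

/-- **`‖[T^r] L_p‖ = 1` from a `SymbolCertL` passing `validLv` AND the unit test `unitL`** (`p ∤ A·H − L`)
(`norm_coeff_eq_one_of_symbolTableLv` with the decidable side conditions bundled; the bound `v < n` is forced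
by `validLv`'s conjunct `p^{n−v} ∤ A·H − L`; `hap` identifies the Frobenius trace used for `A`). For a
certificate passing `validL` (`p ∤ r!`) this is the anom seat's `norm_coeff_eq_one_of_symbolCertL`.
[cite: MazurTateTeitelbaum1986Invent, §I.10–I.13] [cite: SteinWuthrich2013, §3] -/
theorem norm_coeff_eq_one_of_symbolCertLv (W : WeierstrassCurve ℚ) [W.IsElliptic] [W.IsGloballyMinimal]
    {N : ℕ} [NeZero N] {f : CuspForm (Gamma0 N) 2} (hord : IsOrdinaryAt W p) (hf : IsNewformOf W f)
    {ap : ℤ} (hap : W.frobeniusTrace p = ap) (c : SymbolCertL) (hc : c.validLv p ap = true)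
    (hu : c.unitL p = true) (D : ℚ)
    (hD : ‖(D : ℚ_[p])‖ = 1) (hint : ∀ x : ℚ, ‖(ratPlusSymbol f x : ℚ_[p])‖ ≤ 1)
    (htab : ∀ u : ℕ, u < p ^ (c.n + 1) → ¬ p ∣ u →
      ratPlusSymbol f ((u : ℚ) / (p : ℚ) ^ (c.n + 1)) = (c.tabHi.getD u 0 : ℚ) / D ∧
      ratPlusSymbol f ((u : ℚ) / (p : ℚ) ^ c.n) = (c.tabLo.getD u 0 : ℚ) / D) :
    ‖PowerSeries.coeff c.r (padicLFunction f (unitRoot W p : ℚ_[p]))‖ = 1 := by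
  obtain ⟨hp2, hA, hAu, ⟨v, -, hfac, hm, hHL⟩, hcard, hunit, hHi, hLo⟩ := of_decide_eq_true hc
  have hHL1 : ¬ (p : ℤ) ∣ c.A * c.H - c.L := of_decide_eq_true hu
  have hvn : v < c.n := by
    by_contra hle
    rw [Nat.sub_eq_zero_of_le (not_lt.mp hle), pow_zero] at hHL
    exact hHL (one_dvd _)
  rw [← hap] at hA
  exact norm_coeff_eq_one_of_symbolTableLv p hp2 W hord hf v (c.r.factorial / p ^ v) hfac hm c.n hvn
    c.tabHi c.tabLo D hD c.H c.L c.A hA hAu hHL1 hcard hunit hHi hLo hint htab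

end UnitCoeffLv

/-! ## §3. The height-free row of a unit cell of a rank-3 curve passing the odd test -/

namespace AtlasCurve3

variable {C : AtlasCurve3}

/-- **The HEIGHT-FREE row of a RANK-3 unit cell at an ODD good ordinary prime dividing `r!`** (in the parts:
`p = 3`; `AtlasCurve3.heightFreeRow` with `check` replaced by the odd test `checkOdd` of
`Rank2ObservatoryPadicAtlasKitOddFac.lean` and the unit squeeze by `norm_coeff_eq_one_of_symbolCertLv`): for an
odd-checking rank-3 curve `C`, a cell `c ∈ C.cells` passing `unitCheck` (`p ∤ A·H − L`, `p ∤ a_p − 1`), GIVEN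
`hS`, `hex`, `hkato`, `hf`, `hlow : 3 ≤ rank`, the symbol DATA `hint`/`htab`, the census `Surj` at `p`,
`p ∤ ∏c_ℓ` and `p`-primitive admissible multiples: `rank E(ℚ) = 3`, `#Ш(E/ℚ)[p^∞] = 1`, and
`ord_p Reg_p(E, Dh) = 3`, `‖Reg_p‖ = p⁻³` for every canonical `Dh` — no height, regulator or generator
computed. Per cell; NOT a class theorem. [cite: Kato2004Asterisque, Thm. 17.4 (3) (p. 273)]
[cite: BalakrishnanMullerStein2015, Thm. 1.7] [cite: MazurTateTeitelbaum1986Invent, §I.10–I.13]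
[cite: MazurSteinTate2006, Thm. 1.3] [cite: Wuthrich2014, Lemma 20 (p. 399)]
[cite: SteinWuthrich2013, §4.1 and Alg. 11.1] -/
theorem heightFreeRowOdd3 (h : C.checkOdd = true) {c : AtlasCell} (hc : c ∈ C.cells)
    (hu : c.unitCheck = true) [Fact c.p.Prime]
    [(C.e.baseChange ℚ).IsElliptic] [(C.e.baseChange ℚ).IsGloballyMinimal]
    (hS : Schneider1985_order_charGenerator_odd) (hex : mazur_tate_sigma_exists_odd)
    {N : ℕ} [NeZero N] {f : CuspForm (Gamma0 N) 2} (hf : IsNewformOf (C.e.baseChange ℚ) f)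
    (hkato : ∀ (κ : ZpExtension ℚ c.p) (γ : Field.absoluteGaloisGroup ℚ),
      kato_divisibility (C.e.baseChange ℚ) c.p (κ := κ) (γ := γ) (f := f))
    (hlow : 3 ≤ C.row.curve.mordellWeilRank) (D : ℚ) (hD : ‖(D : ℚ_[c.p])‖ = 1)
    (hint : ∀ x : ℚ, ‖(ratPlusSymbol f x : ℚ_[c.p])‖ ≤ 1)
    (htab : ∀ u : ℕ, u < c.p ^ (c.n + 1) → ¬ c.p ∣ u →
      ratPlusSymbol f ((u : ℚ) / (c.p : ℚ) ^ (c.n + 1)) = (c.tabHi.getD u 0 : ℚ) / D ∧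
      ratPlusSymbol f ((u : ℚ) / (c.p : ℚ) ^ c.n) = (c.tabLo.getD (u % c.p ^ c.n) 0 : ℚ) / D)
    (hsurj : Surj (C.e.baseChange ℚ) c.p) (htam : ¬ c.p ∣ (C.e.baseChange ℚ).tamagawaProduct)
    {m : ℕ} (hm : ¬ c.p ∣ m)
    (hadm : ∀ P : (C.e.baseChange ℚ).toAffine.Point, ¬ IsOfFinAddOrder P →
      (C.e.baseChange ℚ).IsAdmissible c.p (m • P)) :
    C.row.curve.mordellWeilRank = 3 ∧
      Nat.card (AddCommGroup.primaryComponent (C.e.baseChange ℚ).sha c.p) = 1 ∧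
      ∀ Dh : PAdicHeightData (C.e.baseChange ℚ) c.p, Dh.IsCanonical →
        (padicRegulator Dh).valuation = 3 ∧ ‖padicRegulator Dh‖ = ((c.p : ℝ)⁻¹) ^ 3 := by
  have hk : c.checkOdd3 C.e = true := cell_checkOdd h hc
  have hp : c.p ≠ 2 := (AtlasCell.sound_of_checkOdd3 hk).2.1
  obtain ⟨hap, hordin, hv⟩ := AtlasCell.rowInputs_of_checkOdd3 (e := C.e) hk
  obtain ⟨hr, ho, -, -, -⟩ := C.padicRowOdd h hc hS hex hf hkato hlow D hD hint htab
  have hbc : C.e.baseChange ℚ = C.row.curve := by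
    ext <;> simp [AtlasCurve3.e, Rank3Row.curve, WeierstrassCurve.baseChange]
  have hrank : (C.e.baseChange ℚ).mordellWeilRank = 3 := by rw [hbc]; exact hr
  have htab' : ∀ u : ℕ, u < c.p ^ (c.certL3.n + 1) → ¬ c.p ∣ u →
      ratPlusSymbol f ((u : ℚ) / (c.p : ℚ) ^ (c.certL3.n + 1)) = (c.certL3.tabHi.getD u 0 : ℚ) / D ∧
      ratPlusSymbol f ((u : ℚ) / (c.p : ℚ) ^ c.certL3.n) = (c.certL3.tabLo.getD u 0 : ℚ) / D :=
    fun u hu' hpu => by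
      rw [AtlasCell.certL3_tabLo_getD c hu']
      exact htab u hu' hpu
  have hcoeff := norm_coeff_eq_one_of_symbolCertLv c.p (C.e.baseChange ℚ) hordin hf hap c.certL3 hv
    (AtlasCell.unitL3_of_unitCheck hu) D hD hint htab'
  have hcoeff' : ‖PowerSeries.coeff (C.e.baseChange ℚ).mordellWeilRank
      (padicLFunction f (unitRoot (C.e.baseChange ℚ) c.p : ℚ_[c.p]))‖ = 1 := by
    rw [hrank]; exact hcoeff
  have hord : (padicLFunction f (unitRoot (C.e.baseChange ℚ) c.p : ℚ_[c.p])).order =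
      (C.e.baseChange ℚ).mordellWeilRank := by rw [hrank]; exact ho
  have hna : ¬ ((c.p : ℤ) ∣ (C.e.baseChange ℚ).frobeniusTrace c.p - 1) := by
    rw [hap]; exact AtlasCell.not_dvd_ap_sub_one_of_unitCheck hu
  obtain ⟨hsha, hreg⟩ := sha_card_eq_one_heightFree_odd hS hex (C.e.baseChange ℚ) c.p f hkato hp
    hordin.1 hordin.2 hsurj hf hord hcoeff' hna htam hm hadm
  refine ⟨hr, hsha, fun Dh hDh => ?_⟩
  have := hreg Dh hDh
  rw [hrank] at this
  exact_mod_cast this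

end AtlasCurve3

/-! ## §4. Exemplar: `18097b1` at `p = 3` (part `P3R3A00`) -/

/-- **Exemplar (kernel, `decide`)**: the `3`-adic cell of the rank-3 curve `18097b1` is a UNIT cell —
`3 ∤ A·H − L = 2·148 + 108 = 404` and `3 ∤ a_3 − 1 = −2`. [cite: MazurTateTeitelbaum1986Invent, §I.10–I.13] -/
theorem unitCheck_c18097b1p3 : (c18097b1p3.cells.all fun c => c.unitCheck) = true := by
  decide

/-- The two kernel tests of `18097b1` at `p = 3` (from the atlas certificate `c18097b1p3_ok`). [folklore] -/
theorem check_c18097b1p3 : c18097b1p3.checkOdd = true ∧ c18097b1p3.minCheck = true := by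
  simpa only [Bool.and_eq_true] using c18097b1p3_ok

/-- `18097b1` is a curve of the landed table `atlasP3R3A00`. [folklore] -/
theorem c18097b1p3_mem : c18097b1p3 ∈ atlasP3R3A00 := by
  simp only [atlasP3R3A00, List.mem_cons, true_or, or_true]

/-- `18097b1 ⊗ ℚ` is elliptic (kernel: `Δ ≠ 0`). [folklore] -/
instance isElliptic_c18097b1p3 : (c18097b1p3.e.baseChange ℚ).IsElliptic :=
  isElliptic_of_mem_atlasP3R3A00 c18097b1p3_mem

/-- The integer model of `18097b1` is globally minimal (kernel: `minCheck`). [cite: SilvermanAEC2009, VII.1 Remark 1.1] -/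
instance isGloballyMinimal_c18097b1p3 : (c18097b1p3.e.baseChange ℚ).IsGloballyMinimal :=
  isGloballyMinimal_of_mem_atlasP3R3A00 c18097b1p3_mem

/-- **`18097b1` at `p = 3`, height-free** (`AtlasCurve3.heightFreeRowOdd3`; `3 ≤ rank` from the tree theorem
`three_le_rank_of_mem_atlasP3R3A00`): GIVEN the named facts `hS`, `hex`, Kato `hkato`, the newform `hf`, the symbol
DATA `hint`/`htab` (`D = 2`), the census bits `Surj(18097b1, 3)` (galrep: no exceptional prime), `3 ∤ ∏c_ℓ = 1`,
and `3`-primitive admissible multiples (`m = #Ẽ(𝔽_3)·∏c_ℓ = 5`): `rank 18097b1(ℚ) = 3`,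
`#Ш(18097b1/ℚ)[3^∞] = 1`, `ord_3 Reg_3 = 3` for every canonical datum. The census height engines A and B both
report `v_3(Reg^{MST}) = 0` and a `3`-adic unit `#Ш_an` at this cell (`DIFF_R3A.tsv`, 12 digits); BSD predicts
`#Ш = 1`. [cite: Kato2004Asterisque, Thm. 17.4 (3) (p. 273)] [cite: BalakrishnanMullerStein2015, Thm. 1.7]
[cite: MazurSteinTate2006, Thm. 1.3] [cite: Wuthrich2014, Lemma 20 (p. 399)] [cite: CremonaAlgorithms1997, Table 1] -/
theorem heightFreeRowOdd3_c18097b1p3 {c : AtlasCell} (hc : c ∈ c18097b1p3.cells) [Fact c.p.Prime]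
    (hS : Schneider1985_order_charGenerator_odd) (hex : mazur_tate_sigma_exists_odd)
    {N : ℕ} [NeZero N] {f : CuspForm (Gamma0 N) 2} (hf : IsNewformOf (c18097b1p3.e.baseChange ℚ) f)
    (hkato : ∀ (κ : ZpExtension ℚ c.p) (γ : Field.absoluteGaloisGroup ℚ),
      kato_divisibility (c18097b1p3.e.baseChange ℚ) c.p (κ := κ) (γ := γ) (f := f))
    (D : ℚ) (hD : ‖(D : ℚ_[c.p])‖ = 1)
    (hint : ∀ x : ℚ, ‖(ratPlusSymbol f x : ℚ_[c.p])‖ ≤ 1)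
    (htab : ∀ u : ℕ, u < c.p ^ (c.n + 1) → ¬ c.p ∣ u →
      ratPlusSymbol f ((u : ℚ) / (c.p : ℚ) ^ (c.n + 1)) = (c.tabHi.getD u 0 : ℚ) / D ∧
      ratPlusSymbol f ((u : ℚ) / (c.p : ℚ) ^ c.n) = (c.tabLo.getD (u % c.p ^ c.n) 0 : ℚ) / D)
    (hsurj : Surj (c18097b1p3.e.baseChange ℚ) c.p)
    (htam : ¬ c.p ∣ (c18097b1p3.e.baseChange ℚ).tamagawaProduct)
    {m : ℕ} (hm : ¬ c.p ∣ m)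
    (hadm : ∀ P : (c18097b1p3.e.baseChange ℚ).toAffine.Point, ¬ IsOfFinAddOrder P →
      (c18097b1p3.e.baseChange ℚ).IsAdmissible c.p (m • P)) :
    c18097b1p3.row.curve.mordellWeilRank = 3 ∧
      Nat.card (AddCommGroup.primaryComponent (c18097b1p3.e.baseChange ℚ).sha c.p) = 1 ∧
      ∀ Dh : PAdicHeightData (c18097b1p3.e.baseChange ℚ) c.p, Dh.IsCanonical →
        (padicRegulator Dh).valuation = 3 ∧ ‖padicRegulator Dh‖ = ((c.p : ℝ)⁻¹) ^ 3 :=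
  AtlasCurve3.heightFreeRowOdd3 check_c18097b1p3.1 hc (List.all_eq_true.mp unitCheck_c18097b1p3 c hc) hS
    hex hf hkato (three_le_rank_of_mem_atlasP3R3A00 c18097b1p3_mem) D hD hint htab hsurj htam hm hadm

end Summit.BirchSwinnertonDyer.BirchSwinnertonDyer.Rank2Observatory

end
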